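import Mathlib
import HarnessLib
import Summits.PneNP.PneNP.Theorems.AeaCutRectanglesTransversalEngine
import Summits.PneNP.PneNP.Theorems.AeaCutRectanglesDutyRectangles
import Summits.PneNP.PneNP.Theorems.AeaCutRectanglesClassCuts
import Summits.PneNP.PneNP.Theorems.AeaCutRectanglesSparseCoreLemma

/-!
# Crux FoolingMeasure (stmt-PneNP-19727) — p4 g5: the UNIT FLOOR of the transversal engine

Companion to `Cruxes/FoolingMeasure/BarrierNotesP4g5.md` §1.  Everything here concerns the HYPOTHESIS of
`AeaCutRectanglesFixedCutFooling.foolingMeasure_of_spreadSystem` (frame `W`, units `π i` of two pairs, D1 cover over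
transversals, D2 witnesses, SPREAD over near-balanced cuts) — never `FoolingMeasure` itself.

Main results (all sorry-free):

* `units_disjoint`            — in a D1 ∧ D2 unit system distinct units are disjoint and every unit pair is loopless
                                 (`not_isDiag_of_mem`); hence the pair graph `D = ⋃ πᵢ` has exactly `2m` edges
                                 (`card_pairGraph`).
* `exists_bisection_splits_le_half` — **UNIT FLOOR**: every D1 ∧ D2 unit system on `Fin n` with `m` units has an
                                 EXACT `⌊n/2⌋`-cut splitting at most `m/2` units (averaging over all `⌊n/2⌋`-sets via the
                                 landed `AeaCutRectanglesSparseCoreLemma.exists_subset_few_edges`; a split unit has a pair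
                                 inside the cut, and the inside pairs of distinct units are distinct).
* `two_mul_le_units_of_spread`, `units_ge_nlogn_of_spread` — consequently the SPREAD clause of the engine at window `ε`
                                 (with `ε·n ≥ 1/2`) and demand `(n/2)·log₂ n + C·n` forces `m ≥ n·log₂ n + 2·C·n`:
                                 the engine can only fire on systems with SUPERLINEARLY many units.
* `noSpread_iff_superlinear`  — the engine-level kill target `NoSpread` (BarrierNotesP4g4 §1, restated verbatim here as
                                 Cruxes modules are not importable on the farm) is EQUIVALENT to its restriction to systems
                                 with `m ≥ n·log₂ n + 2·C·n` units.
* `LinearOrZero K`            — the recommended typing of the kill conjecture ("a D1 ∧ D2 system with more than `K·n`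
                                 units has a near-bisection splitting no unit"): `linearOrZero_zero_iff` (K = 0 is g4's
                                 `ZeroBisection`), `LinearOrZero.mono`, `noSpread_of_linearOrZero` (any K suffices for
                                 the kill).  Unlike `ZeroBisection` it is refutable only by the objects that matter
                                 (superlinear-m systems without zero cuts; none is known — BarrierNotesP4g5 §2).

* `two_colour_private_pairs_le` — TOY CONTRAST (§4): over TWO colours, colourings `cᵢ : Fin n → ZMod 2` with private
                                 monochromatic pairs (`cᵢ` mono on pair `i`, bichromatic on every pair `j ≠ i`) number at
                                 most `n + 1` (F₂-linear independence).  Over three colours the same count is Θ(n²)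
                                 (degree-2 indicators give ≤ (n²+n+2)/2, BarrierNotesP4g3 (2c); dense 4-critical graphs give
                                 ≥ n²/16), so the 2-colour analogue's linear cap is pure F₂-linearity of privacy and is NOT
                                 evidence for the 3-colour dichotomy (correcting the use made of it in BarrierNotesP4g4 §2 (ii)).

Remark (not formalised; elementary inclusion–exclusion): counting units split EXACTLY (one pair inside, the other not)
the average over `⌊n/2⌋`-sets is `(3/8 + O(1/n))·m`, so SPREAD even forces `m ≥ (4/3 − o(1))·n·log₂ n + (8/3)·C·n`.

HONEST FRAMING: elementary finite combinatorics (double counting); FRONTIER material about one engine for one crux of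
one route; nothing here bears on P vs NP.
-/

set_option linter.dupNamespace false

namespace Summit.PneNP.PneNP.Cruxes.FoolingMeasure.P4g5

open Finset
open Summit.PneNP.PneNP.Theorems.AeaCutRectanglesTransversalEngine
open Summit.PneNP.PneNP.Theorems.AeaCutRectanglesDutyRectangles
open Summit.PneNP.PneNP.Theorems.AeaCutRectanglesClassCuts
open Summit.PneNP.PneNP.Theorems.AeaCutRectanglesSparseCoreLemma

/-- A D1 ∧ D2 UNIT SYSTEM on `Fin n` with `m` units: verbatim the first three conjuncts of the hypothesis of
`foolingMeasure_of_spreadSystem` (and verbatim `Cruxes/FoolingMeasure/ZeroCutCellCuts.lean`'s `P4g4.IsUnitSystem`,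
restated because Cruxes workfiles are not importable). -/
def IsUnitSystem (n m : ℕ) (W : Finset (Sym2 (Fin n))) (π : Fin m → Finset (Sym2 (Fin n))) : Prop :=
  (∀ i, (π i).card = 2) ∧
  (∀ t : Fin m → Sym2 (Fin n), (∀ i, t i ∈ π i) →
    (∀ e ∈ tg W t, ¬ e.IsDiag) ∧ ¬ (SimpleGraph.fromEdgeSet (↑(tg W t) : Set (Sym2 (Fin n)))).Colorable 3) ∧
  (∀ i, (SimpleGraph.fromEdgeSet (↑(gammaMinus W π i) : Set (Sym2 (Fin n)))).Colorable 3)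

variable {n m : ℕ} {W : Finset (Sym2 (Fin n))} {π : Fin m → Finset (Sym2 (Fin n))}

/-! ### §0  Basic anatomy: units are nonempty, loopless, pairwise disjoint -/

theorem unit_nonempty (hsys : IsUnitSystem n m W π) (i : Fin m) : (π i).Nonempty :=
  card_pos.1 (by rw [hsys.1 i]; norm_num)

/-- Every unit pair is loopless (it lies on a transversal, and transversal graphs are loopless by D1). -/
theorem not_isDiag_of_mem (hsys : IsUnitSystem n m W π) {i : Fin m} {e : Sym2 (Fin n)} (he : e ∈ π i) :
    ¬ e.IsDiag := by
  classical
  let t : Fin m → Sym2 (Fin n) := fun j => if j = i then e else (unit_nonempty hsys j).choose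
  have ht : ∀ j, t j ∈ π j := by
    intro j
    by_cases hj : j = i
    · subst hj; simp [t, he]
    · simp [t, hj, (unit_nonempty hsys j).choose_spec]
  have h := (hsys.2.1 t ht).1 (t i) (mem_tg.2 (Or.inr ⟨i, rfl⟩))
  simpa [t] using h

/-- In a D1 ∧ D2 system every D2 witness of unit `i` makes BOTH pairs of unit `i` monochromatic (cover applied to the
witness along a transversal through the given pair).  [Same proof as `P4g4.unit_mono_of_witness`.] -/
theorem unit_mono_of_witness (hsys : IsUnitSystem n m W π) {i : Fin m} {c : Fin n → Fin 3}
    (hc : c ∉ killSet (gammaMinus W π i)) {e : Sym2 (Fin n)} (he : e ∈ π i) : (e.map c).IsDiag := by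
  classical
  let t : Fin m → Sym2 (Fin n) := fun j => if j = i then e else (unit_nonempty hsys j).choose
  have ht : ∀ j, t j ∈ π j := by
    intro j
    by_cases hj : j = i
    · subst hj; simp [t, he]
    · simp [t, hj, (unit_nonempty hsys j).choose_spec]
  obtain ⟨-, hnc⟩ := hsys.2.1 t ht
  obtain ⟨e', he', hd', hm'⟩ := (not_colorable_iff_forall_mem_killSet _).1 hnc c
  rcases mem_tg.1 he' with hW | ⟨j, rfl⟩
  · exact absurd ⟨e', mem_gammaMinus.2 (Or.inl hW), hd', hm'⟩ hc
  · by_cases hj : j = i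
    · subst hj; simpa [t] using hm'
    · exact absurd ⟨t j, mem_gammaMinus.2 (Or.inr ⟨j, hj, ht j⟩), hd', hm'⟩ hc

/-- **Distinct units are disjoint.**  (A shared pair would be monochromatic under the D2 witness of one unit and, lying
in `Γ − πᵢ` through the other unit, properly coloured by the same witness.) -/
theorem units_disjoint (hsys : IsUnitSystem n m W π) {i j : Fin m} (hij : i ≠ j) : Disjoint (π i) (π j) := by
  rw [Finset.disjoint_left]
  intro e hei hej
  obtain ⟨c, hc⟩ := (colorable_iff_exists_not_mem_killSet _).1 (hsys.2.2 i)
  exact hc ⟨e, mem_gammaMinus.2 (Or.inr ⟨j, hij.symm, hej⟩), not_isDiag_of_mem hsys hei,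
    unit_mono_of_witness hsys hc hei⟩

/-! ### §1  The pair graph and the UNIT FLOOR -/

/-- The pair graph `D = ⋃ᵢ πᵢ` of a unit system. -/
def pairGraph (π : Fin m → Finset (Sym2 (Fin n))) : Finset (Sym2 (Fin n)) := univ.biUnion π

theorem mem_pairGraph {e : Sym2 (Fin n)} : e ∈ pairGraph π ↔ ∃ i, e ∈ π i := by
  simp [pairGraph]

/-- `|D| = 2m`. -/
theorem card_pairGraph (hsys : IsUnitSystem n m W π) : (pairGraph π).card = 2 * m := by
  have hpd : ((univ : Finset (Fin m)) : Set (Fin m)).PairwiseDisjoint π := by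
    intro i _ j _ hij
    exact units_disjoint hsys hij
  unfold pairGraph
  rw [card_biUnion hpd]
  simp [hsys.1, mul_comm]

/-- A split unit has a pair inside the cut; inside pairs of distinct units are distinct: `s(B) ≤ e_D(B)`. -/
theorem card_splitUnits_le_card_bobSide (hsys : IsUnitSystem n m W π) (B : Finset (Fin n)) :
    (splitUnits π B).card ≤ (bobSide B (pairGraph π)).card := by
  classical
  have hbob : bobSide B (pairGraph π) = univ.biUnion (fun i => (π i).filter fun e => ∀ v ∈ e, v ∈ B) := by
    ext e
    simp only [mem_bobSide, mem_pairGraph, mem_biUnion, mem_univ, true_and, mem_filter]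
    exact ⟨fun ⟨⟨i, hi⟩, h⟩ => ⟨i, hi, h⟩, fun ⟨i, hi, h⟩ => ⟨⟨i, hi⟩, h⟩⟩
  have hpd : ((univ : Finset (Fin m)) : Set (Fin m)).PairwiseDisjoint
      (fun i => (π i).filter fun e => ∀ v ∈ e, v ∈ B) := by
    intro i _ j _ hij
    exact disjoint_filter_filter (units_disjoint hsys hij)
  rw [hbob, card_biUnion hpd]
  calc (splitUnits π B).card = ∑ i ∈ splitUnits π B, 1 := by simp
    _ ≤ ∑ i ∈ splitUnits π B, ((π i).filter fun e => ∀ v ∈ e, v ∈ B).card := by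
        refine sum_le_sum fun i hi => ?_
        obtain ⟨⟨e, he, heB⟩, -⟩ := mem_splitUnits.1 hi
        exact card_pos.2 ⟨e, mem_filter.2 ⟨he, heB⟩⟩
    _ ≤ ∑ i, ((π i).filter fun e => ∀ v ∈ e, v ∈ B).card := sum_le_sum_of_subset (subset_univ _)

/-- **UNIT FLOOR (counting form).**  Some exact `⌊n/2⌋`-cut `B` has `s(B)·n(n−1) ≤ 2m·⌊n/2⌋(⌊n/2⌋−1)`. -/
theorem exists_bisection_few_splits (hsys : IsUnitSystem n m W π) :
    ∃ B : Finset (Fin n), B.card = n / 2 ∧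
      (splitUnits π B).card * (n * (n - 1)) ≤ 2 * m * (n / 2 * (n / 2 - 1)) := by
  classical
  have hE : ∀ e ∈ pairGraph π, ¬ e.IsDiag ∧ ∀ v ∈ e, v ∈ (univ : Finset (Fin n)) := by
    intro e he
    obtain ⟨i, hei⟩ := mem_pairGraph.1 he
    exact ⟨not_isDiag_of_mem hsys hei, fun v _ => mem_univ v⟩
  obtain ⟨S, -, hScard, hS⟩ :=
    exists_subset_few_edges (n / 2) n univ (pairGraph π) (by simp) (Nat.div_le_self n 2) hE
  refine ⟨S, hScard, ?_⟩
  calc (splitUnits π S).card * (n * (n - 1))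
      ≤ (bobSide S (pairGraph π)).card * (n * (n - 1)) :=
        Nat.mul_le_mul_right _ (card_splitUnits_le_card_bobSide hsys S)
    _ ≤ (pairGraph π).card * (n / 2 * (n / 2 - 1)) := hS
    _ = 2 * m * (n / 2 * (n / 2 - 1)) := by rw [card_pairGraph hsys]

private theorem four_half_le (n : ℕ) (hn : 2 ≤ n) : 2 * (2 * (n / 2 * (n / 2 - 1))) ≤ n * (n - 1) := by
  have h2 : 2 * (n / 2) ≤ n := Nat.mul_div_le n 2
  have ha : 1 ≤ n / 2 := by omega
  have hn1 : 1 ≤ n := by omega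
  zify [ha, hn1]
  have h2' : (2 : ℤ) * (n / 2 : ℕ) ≤ n := by exact_mod_cast h2
  nlinarith [h2', mul_nonneg (sub_nonneg.2 h2') (by linarith : (0 : ℤ) ≤ (n : ℤ) + 2 * ((n / 2 : ℕ) : ℤ) - 1)]

/-- **UNIT FLOOR.**  Every D1 ∧ D2 unit system with `m` units has an exact `⌊n/2⌋`-cut splitting at most `m/2` units. -/
theorem exists_bisection_splits_le_half (hsys : IsUnitSystem n m W π) :
    ∃ B : Finset (Fin n), B.card = n / 2 ∧ 2 * (splitUnits π B).card ≤ m := by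
  obtain ⟨B, hB, h⟩ := exists_bisection_few_splits hsys
  refine ⟨B, hB, ?_⟩
  rcases Nat.lt_or_ge n 2 with hn | hn
  · -- `n ≤ 1`: every pair is a loop, so no unit pair exists inside any cut and nothing is split
    have hsub : Subsingleton (Fin n) := ⟨fun a b => Fin.ext (by have := a.isLt; have := b.isLt; omega)⟩
    have h0 : splitUnits π B = ∅ := by
      refine eq_empty_of_forall_notMem fun i hi => ?_
      obtain ⟨⟨e, he, -⟩, -⟩ := mem_splitUnits.1 hi
      exact not_isDiag_of_mem hsys he
        (Sym2.inductionOn e fun a b => (Sym2.mk_isDiag_iff).2 (Subsingleton.elim a b))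
    simp [h0]
  · have hpos : 0 < n * (n - 1) := Nat.mul_pos (by omega) (by omega)
    have key : 2 * (splitUnits π B).card * (n * (n - 1)) ≤ m * (n * (n - 1)) :=
      calc 2 * (splitUnits π B).card * (n * (n - 1))
          = 2 * ((splitUnits π B).card * (n * (n - 1))) := by ring
        _ ≤ 2 * (2 * m * (n / 2 * (n / 2 - 1))) := Nat.mul_le_mul_left _ h
        _ = m * (2 * (2 * (n / 2 * (n / 2 - 1)))) := by ring
        _ ≤ m * (n * (n - 1)) := Nat.mul_le_mul_left _ (four_half_le n hn)
    exact Nat.le_of_mul_le_mul_right key hpos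

/-! ### §2  Consequences for SPREAD -/

/-- The SPREAD clause of the engine hypothesis (4th conjunct of `foolingMeasure_of_spreadSystem`) at window
half-width `ε` and demand `T`: every near-balanced cut splits at least `T` units. -/
def Spread (ε T : ℝ) (π : Fin m → Finset (Sym2 (Fin n))) : Prop :=
  ∀ B : Finset (Fin n), (1 / 2 - ε) * (n : ℝ) ≤ B.card → (B.card : ℝ) ≤ (1 / 2 + ε) * n →
    ∃ I : Finset (Fin m), T ≤ I.card ∧ ∀ i ∈ I, (∃ e ∈ π i, ∀ v ∈ e, v ∈ B) ∧ (∃ e ∈ π i, ∃ v ∈ e, v ∉ B)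

theorem le_card_splitUnits_of_spread {ε T : ℝ} (h : Spread ε T π) {B : Finset (Fin n)}
    (hB1 : (1 / 2 - ε) * (n : ℝ) ≤ B.card) (hB2 : (B.card : ℝ) ≤ (1 / 2 + ε) * n) :
    T ≤ (splitUnits π B).card := by
  obtain ⟨I, hT, hI⟩ := h B hB1 hB2
  refine hT.trans ?_
  exact_mod_cast card_le_card (fun i hi => mem_splitUnits.2 (hI i hi))

/-- A near-bisection (`⌊n/2⌋ ≤ |B| ≤ ⌈n/2⌉`) lies in every window once `ε·n ≥ 1/2`. -/
theorem near_bisection_mem_window {ε : ℝ} (hεn : 1 ≤ 2 * ε * n) {B : Finset (Fin n)}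
    (hB1 : n / 2 ≤ B.card) (hB2 : B.card ≤ (n + 1) / 2) :
    (1 / 2 - ε) * (n : ℝ) ≤ B.card ∧ (B.card : ℝ) ≤ (1 / 2 + ε) * n := by
  have h1 : (n : ℝ) ≤ 2 * (B.card : ℝ) + 1 := by exact_mod_cast (by omega : n ≤ 2 * B.card + 1)
  have h2 : 2 * (B.card : ℝ) ≤ n + 1 := by exact_mod_cast (by omega : 2 * B.card ≤ n + 1)
  have hn : (0 : ℝ) ≤ n := Nat.cast_nonneg n
  constructor <;> nlinarith [hεn, h1, h2, hn]

/-- **UNIT FLOOR vs SPREAD.**  An `(ε,T)`-spread D1 ∧ D2 unit system with `ε·n ≥ 1/2` has `m ≥ 2T` units. -/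
theorem two_mul_le_units_of_spread (hsys : IsUnitSystem n m W π) {ε T : ℝ}
    (hεn : 1 ≤ 2 * ε * n) (h : Spread ε T π) : 2 * T ≤ m := by
  obtain ⟨B, hB, hhalf⟩ := exists_bisection_splits_le_half hsys
  obtain ⟨hB1, hB2⟩ := near_bisection_mem_window hεn hB.symm.le (by omega)
  have hT := le_card_splitUnits_of_spread h hB1 hB2
  have : (2 * (splitUnits π B).card : ℝ) ≤ m := by exact_mod_cast hhalf
  linarith

/-- In the engine's units: SPREAD with demand `(n/2)·log₂ n + C·n` forces `m ≥ n·log₂ n + 2·C·n` — the engine can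
only fire on systems with superlinearly many units. -/
theorem units_ge_nlogn_of_spread (hsys : IsUnitSystem n m W π) {ε : ℝ} {C : ℕ}
    (hεn : 1 ≤ 2 * ε * n) (h : Spread ε ((n : ℝ) / 2 * Real.logb 2 n + (C : ℝ) * n) π) :
    (n : ℝ) * Real.logb 2 n + 2 * (C : ℝ) * n ≤ m := by
  have := two_mul_le_units_of_spread hsys hεn h
  linarith

/-! ### §3  The kill target lives in the superlinear regime -/

/-- **NoSpread** — the engine-level kill target (verbatim `P4g4.NoSpread` over the restated `IsUnitSystem`): for every
window half-width `ε > 0` there is `C` such that, for all large `n`, EVERY D1 ∧ D2 unit system on `Fin n` has a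
near-balanced cut splitting fewer than `(n/2)·log₂ n + C·n` units. -/
def NoSpread : Prop :=
  ∀ ε : ℝ, 0 < ε → ∃ C : ℕ, ∀ᶠ n in Filter.atTop, ∀ (m : ℕ) (W : Finset (Sym2 (Fin n)))
    (π : Fin m → Finset (Sym2 (Fin n))), IsUnitSystem n m W π →
      ∃ B : Finset (Fin n), (1 / 2 - ε) * (n : ℝ) ≤ B.card ∧ (B.card : ℝ) ≤ (1 / 2 + ε) * n ∧
        ((splitUnits π B).card : ℝ) < (n : ℝ) / 2 * Real.logb 2 n + (C : ℝ) * n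

/-- `NoSpread` restricted to systems with at least `n·log₂ n + 2·C·n` units. -/
def NoSpreadSuperlinear : Prop :=
  ∀ ε : ℝ, 0 < ε → ∃ C : ℕ, ∀ᶠ n in Filter.atTop, ∀ (m : ℕ) (W : Finset (Sym2 (Fin n)))
    (π : Fin m → Finset (Sym2 (Fin n))), IsUnitSystem n m W π →
      (n : ℝ) * Real.logb 2 n + 2 * (C : ℝ) * n ≤ m →
      ∃ B : Finset (Fin n), (1 / 2 - ε) * (n : ℝ) ≤ B.card ∧ (B.card : ℝ) ≤ (1 / 2 + ε) * n ∧
        ((splitUnits π B).card : ℝ) < (n : ℝ) / 2 * Real.logb 2 n + (C : ℝ) * n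

private theorem one_le_two_mul_eps {ε : ℝ} (hε : 0 < ε) {N n : ℕ} (hN : 1 / (2 * ε) < N) (hnN : N ≤ n) :
    1 ≤ 2 * ε * n := by
  have h1 : 1 / (2 * ε) < n := hN.trans_le (by exact_mod_cast hnN)
  have h2 : 1 / (2 * ε) * (2 * ε) = 1 := by field_simp
  nlinarith [h1, h2, hε]

/-- **The kill target lives entirely in the superlinear regime**: by the UNIT FLOOR, systems with fewer than
`n·log₂ n + 2·C·n` units are never spread. -/
theorem noSpread_iff_superlinear : NoSpread ↔ NoSpreadSuperlinear := by
  constructor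
  · intro h ε hε
    obtain ⟨C, hC⟩ := h ε hε
    exact ⟨C, hC.mono fun n hn m W π hsys _ => hn m W π hsys⟩
  · intro h ε hε
    obtain ⟨C, hC⟩ := h ε hε
    obtain ⟨N, hN⟩ := exists_nat_gt (1 / (2 * ε))
    refine ⟨C, (hC.and (Filter.eventually_ge_atTop N)).mono fun n hn m W π hsys => ?_⟩
    obtain ⟨hn, hnN⟩ := hn
    by_cases hm : (n : ℝ) * Real.logb 2 n + 2 * (C : ℝ) * n ≤ m
    · exact hn m W π hsys hm
    · push Not at hm
      have hεn : 1 ≤ 2 * ε * n := one_le_two_mul_eps hε hN hnN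
      obtain ⟨B, hB, hhalf⟩ := exists_bisection_splits_le_half hsys
      obtain ⟨hB1, hB2⟩ := near_bisection_mem_window hεn hB.symm.le (by omega)
      refine ⟨B, hB1, hB2, ?_⟩
      have : (2 * (splitUnits π B).card : ℝ) ≤ m := by exact_mod_cast hhalf
      linarith

/-- **LINEAR-OR-ZERO(K)** — recommended typing of the kill conjecture: every D1 ∧ D2 unit system with more than `K·n`
units has a near-bisection (`⌊n/2⌋ ≤ |B| ≤ ⌈n/2⌉`) that splits NO unit. -/
def LinearOrZero (K : ℕ) : Prop :=
  ∀ (n m : ℕ) (W : Finset (Sym2 (Fin n))) (π : Fin m → Finset (Sym2 (Fin n))), IsUnitSystem n m W π →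
    K * n < m → ∃ B : Finset (Fin n), n / 2 ≤ B.card ∧ B.card ≤ (n + 1) / 2 ∧ splitUnits π B = ∅

/-- **ZeroBisection** (verbatim `P4g4.ZeroBisection`): every D1 ∧ D2 unit system has a near-bisection splitting no unit. -/
def ZeroBisection : Prop :=
  ∀ (n m : ℕ) (W : Finset (Sym2 (Fin n))) (π : Fin m → Finset (Sym2 (Fin n))), IsUnitSystem n m W π →
    ∃ B : Finset (Fin n), n / 2 ≤ B.card ∧ B.card ≤ (n + 1) / 2 ∧ splitUnits π B = ∅

theorem LinearOrZero.mono {K K' : ℕ} (h : LinearOrZero K) (hKK' : K ≤ K') : LinearOrZero K' :=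
  fun n m W π hsys hm => h n m W π hsys (lt_of_le_of_lt (Nat.mul_le_mul_right _ hKK') hm)

/-- `K = 0` is g4's `ZeroBisection` (systems without units have zero cuts trivially). -/
theorem linearOrZero_zero_iff : LinearOrZero 0 ↔ ZeroBisection := by
  constructor
  · intro h n m W π hsys
    rcases Nat.eq_zero_or_pos m with hm | hm
    · subst hm
      obtain ⟨B, -, hB⟩ := Finset.exists_subset_card_eq
        (show n / 2 ≤ (univ : Finset (Fin n)).card by simpa using Nat.div_le_self n 2)
      exact ⟨B, hB.symm.le, by omega, Finset.eq_empty_of_isEmpty _⟩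
    · exact h n m W π hsys (by simpa using hm)
  · intro h n m W π hsys _
    exact h n m W π hsys

/-- **Any `LinearOrZero K` kills the engine.** -/
theorem noSpread_of_linearOrZero {K : ℕ} (h : LinearOrZero K) : NoSpread := by
  rw [noSpread_iff_superlinear]
  intro ε hε
  obtain ⟨N, hN⟩ := exists_nat_gt (1 / (2 * ε))
  refine ⟨K, (Filter.eventually_ge_atTop (max N 2)).mono fun n hn m W π hsys hm => ?_⟩
  have hn2 : 2 ≤ n := le_of_max_le_right hn
  have hnN : N ≤ n := le_of_max_le_left hn
  have hεn : 1 ≤ 2 * ε * n := one_le_two_mul_eps hε hN hnN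
  have hlog : 0 < Real.logb 2 (n : ℝ) := Real.logb_pos (by norm_num) (by exact_mod_cast hn2)
  have hn0 : (0 : ℝ) < n := by exact_mod_cast (by omega : 0 < n)
  have hKm : K * n < m := by
    have : ((K * n : ℕ) : ℝ) < m := by
      push_cast
      nlinarith [hm, hlog, hn0, mul_pos hn0 hlog]
    exact_mod_cast this
  obtain ⟨B, hB1, hB2, h0⟩ := h n m W π hsys hKm
  obtain ⟨hw1, hw2⟩ := near_bisection_mem_window hεn hB1 hB2
  refine ⟨B, hw1, hw2, ?_⟩
  rw [h0, card_empty, Nat.cast_zero]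
  nlinarith [mul_pos hn0 hlog, hn0]

theorem noSpread_of_zeroBisection (h : ZeroBisection) : NoSpread :=
  noSpread_of_linearOrZero (linearOrZero_zero_iff.2 h)

/-! ### §4  Toy contrast: private monochromatic pairs over two colours

In the 2-colour analogue of the engine (non-bipartiteness), D2 witnesses are `ZMod 2`-valued and "pair `j` is bichromatic
under `cᵢ`" is the LINEAR condition `cᵢ (u j) + cᵢ (v j) = 1`.  Privacy alone then caps the number of units at `n + 1`:
the witnesses `c₁, …, c_{m−1}` are linearly independent over `ZMod 2` (test a dependency against the functionals
`x ↦ x (u j) + x (v j)`).  Over three colours the corresponding indicator `1 − (x (u j) − x (v j))²` has degree 2 and the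
count is Θ(n²) — see the module docstring. -/

/-- **Two colours: at most `n + 1` colourings with private monochromatic pairs.**  If `cᵢ : Fin n → ZMod 2` (i < m) and
pairs `(u i, v i)` satisfy `cᵢ (u i) = cᵢ (v i)` and `cᵢ (u j) ≠ cᵢ (v j)` for `j ≠ i`, then `m ≤ n + 1`. -/
theorem two_colour_private_pairs_le {n m : ℕ} (c : Fin m → Fin n → ZMod 2) (u v : Fin m → Fin n)
    (hmono : ∀ i, c i (u i) = c i (v i)) (hbi : ∀ i j, i ≠ j → c i (u j) ≠ c i (v j)) : m ≤ n + 1 := by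
  have h01 : ∀ x : ZMod 2, x = 0 ∨ x = 1 := by decide
  have hsum : ∀ i j, c i (u j) + c i (v j) = if i = j then 0 else 1 := by
    intro i j
    by_cases hij : i = j
    · subst hij
      rw [if_pos rfl, hmono i]
      rcases h01 (c i (v i)) with h | h <;> rw [h] <;> decide
    · rw [if_neg hij]
      have hne := hbi i j hij
      rcases h01 (c i (u j)) with h | h <;> rcases h01 (c i (v j)) with h' | h' <;> simp_all
  cases m with
  | zero => omega
  | succ m' =>
    suffices hli : LinearIndependent (ZMod 2) (fun i : Fin m' => c i.castSucc) by
      have := hli.fintype_card_le_finrank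
      simp only [Fintype.card_fin, Module.finrank_fintype_fun_eq_card] at this
      omega
    rw [Fintype.linearIndependent_iff]
    intro g hg i₀
    have key : ∀ j : Fin (m' + 1), ∑ i : Fin m', g i * (if i.castSucc = j then 0 else 1) = 0 := by
      intro j
      have h1 := congrFun hg (u j)
      have h2 := congrFun hg (v j)
      simp only [Finset.sum_apply, Pi.smul_apply, smul_eq_mul, Pi.zero_apply] at h1 h2
      calc ∑ i : Fin m', g i * (if i.castSucc = j then 0 else 1)
          = ∑ i : Fin m', g i * (c i.castSucc (u j) + c i.castSucc (v j)) := by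
            refine sum_congr rfl fun i _ => ?_
            rw [hsum]
        _ = ∑ i : Fin m', g i * c i.castSucc (u j) + ∑ i : Fin m', g i * c i.castSucc (v j) := by
            rw [← sum_add_distrib]
            exact sum_congr rfl fun i _ => mul_add _ _ _
        _ = 0 := by rw [h1, h2, add_zero]
    have hall : ∑ i : Fin m', g i = 0 := by
      have := key (Fin.last m')
      simpa [Fin.castSucc_lt_last, ne_of_lt] using this
    have hbut : ∑ i : Fin m', g i - g i₀ = 0 := by
      have hk := key i₀.castSucc
      have hterm : ∀ i : Fin m', g i * (if i.castSucc = i₀.castSucc then (0 : ZMod 2) else 1)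
          = g i - (if i = i₀ then g i else 0) := by
        intro i
        by_cases hi : i = i₀
        · subst hi; simp
        · simp [hi, Fin.castSucc_inj]
      rw [sum_congr rfl fun i _ => hterm i, sum_sub_distrib, sum_ite_eq' univ i₀, if_pos (mem_univ _)] at hk
      exact hk
    have : g i₀ = ∑ i : Fin m', g i - (∑ i : Fin m', g i - g i₀) := by ring
    rw [this, hbut, hall, sub_zero]

end Summit.PneNP.PneNP.Cruxes.FoolingMeasure.P4g5
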